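import Literature.MathematicalPhysics.QuantumLattice.VariationalPrincipleBogoliubovInequality
import Literature.MathematicalPhysics.QuantumLattice.PeriodicVariationalEquilibria
import HarnessLib

/-!
# The local KMS rows, stationarity and Bogoliubov's inequality for every PERIODIC equilibrium state of an even finite-range
# translation-covariant lattice-fermion interaction on `ℤ^d`

Topic `Literature/MathematicalPhysics/QuantumLattice` (family `hubbard`; the `q`-periodic twin of `VariationalPrincipleLocalKMSRows`
and `VariationalPrincipleBogoliubovInequality`, for the periodic equilibrium states `InfVolFermionState.IsPerVarEquilibrium` of
`PeriodicVariationalEquilibria` — the states in which staggered / striped / pair-density-wave order of period `q` would live).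

**Araki–Moriya, Rev. Math. Phys. 15 (2003) 93, Theorem 12.11** (variational principle ⇒ dKMS) is stated for translation-invariant
solutions of the variational principle; Israel (*Convexity in the Theory of Lattice Gases*, Thm. I.2.4 and §II.3) and Bratteli–Robinson
(Thm. 6.2.42) record that the same implication holds for the PERIODIC solutions of the periodic variational principle
`s̄(ω) − β ē_q(ω) = P_q(β,Ψ)` (a `q`-periodic system is a translation-invariant system over the superlattice `⊕_i (q_i+1)ℤ` with a larger
one-cell algebra). This file PROVES it in the tree's formalism, for every Hermitian, even, translation-covariant `Ψ` of finite range `R`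
on `ℤ^d` (`d ≥ 1`), every `β ≥ 0`, every period vector `q` and every `ω` with `ω.IsPerVarEquilibrium β q Ψ R`
(`ω` `q`-periodic and `s̄(ω) − β ē_q(ω) = P_q(β,Ψ,R)`; by `PeriodicGibbsVariationalPrinciple`, `P_q = P_free` for translation-covariant `Ψ`):

* §3 **the perturbation principle** `IsPerVarEquilibrium.re_expect_nonneg_of_gibbs_perturbation(_const)`: `Re ω(X) ≥ 0` for every even
  Hermitian local `X` whose SUPERLATTICE translates are controlled to first order in the perturbed box Gibbs states (the engine of
  `VariationalPrincipleLocalKMSRows` §5 with the `m^d` unit translates replaced by `k^d` superlattice translates in an aligned box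
  `[0,(k+w₀)N)^d`, `N = Π_i(q_i+1)`; ratio `k^d/((k+w₀)N)^d → N^{-d} > 0`);
* §4 the rows: **`(C-2)`** `IsPerVarEquilibrium.re_expect_eebRow_nonneg` (`0 ≤ Re ω(βÃᴴ[H_{Λ'},Ã] − sÃᴴÃ + qÃÃᴴ)`, `e^{s−1} ≤ q`),
  **`(C-1)`** `IsPerVarEquilibrium.im_expect_conjTranspose_mul_commutator_eq_zero` (`β ≥ 0`; at `β = 0` through
  `IsPeriodic.expect_eq_trace_div_of_entropy_max`: a periodic state of entropy density `2 log 2` is tracial on every aligned box),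
  **STATIONARITY** `IsPerVarEquilibrium.expect_commutator_localHamiltonian_eq_zero` (`ω(H_{Λ'}Ã − ÃH_{Λ'}) = 0` for every local `A`);
* §5 **BOGOLIUBOV'S INEQUALITY** `IsPerVarEquilibrium.bogoliubovRow_nonneg` / `IsPerVarEquilibrium.bogoliubov_inequality`
  (`‖ω(C̃Ã − ÃC̃)‖² ≤ ½β Re ω(ÃÃᴴ + ÃᴴÃ) Re ω(C̃ᴴ[H_{Λ'},C̃] − [H_{Λ'},C̃]C̃ᴴ)`), the input of the Mermin–Wagner criterion
  for periodic equilibrium states.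

Consistency: a translation-invariant equilibrium state is a `q`-periodic equilibrium state for every `q`
(`IsVarEquilibrium.isPerVarEquilibrium`, `PeriodicPressureSuperlatticeIndependence`), so these rows contain those of
`VariationalPrincipleLocalKMSRows` §8; conversely they are NEW for the genuinely periodic equilibria (staggered / striped / density-wave
candidates: `PeriodicVariationalEquilibria`, `PeriodicSublatticeAndStaggeredTerms`), whose cell average
(`IsPerVarEquilibrium.cellAverage_isVarEquilibrium`) forgets every staggered one-point function.

Everything is PROVED (standard axioms); no definition, no named fact. The interaction is kept translation-COVARIANT (only the state is
periodic): this is what the applications need (Hubbard-type models; the competing orders are properties of the state), and it keeps the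
locality identity `[H_{[0,n)^d}, Γ(τ_u)Ã] = Γ(τ_u)[H_{Λ'},Ã]` of `VariationalPrincipleLocalKMSRows` §4 available for every offset `u`.
-- TODO(general form): `q`-periodic `Ψ` (superlattice-covariant potentials), Araki–Moriya §8 / Israel §II.3.

## The proof

Identical to `VariationalPrincipleLocalKMSRows` (perturb the interaction by a sum of translates of `X`, Peierls–Bogoliubov to second
order, Gibbs' variational inequality for the box marginal of `ω`, divide by the volume), with three changes: (i) the translates are the
`k^d` SUPERLATTICE translates `Γ(τ_{ℓ(z)+v})X`, `ℓ(z) = ((q_i+1)z_i)_i`, `z ∈ [0,k)^d`, placed in the aligned box `[0,(k+w₀)N)^d`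
(`Λ' + v ⊆ [0,w₀N)^d`, `v` itself a superlattice vector), on each of which the periodic `ω` takes the value `ω(X)`
(`IsPeriodic.shift_superlatVec`); (ii) the entropy and the energy of aligned boxes are `s̄(ω)·vol + o(vol)`
(`IsPeriodic.tendsto_boxEntropyDensity_mul`) and `ē_q(ω)·vol + O(collar)` (`IsPeriodic.abs_pow_mul_cellMeanEnergy_sub_le`);
(iii) the density of translates is `k^d/((k+w₀)N)^d → N^{-d}`, still positive. The first-order (graded-locality) control of the
translates is proved here for an ARBITRARY finite family of offsets (§2), which both engines could share.

## Mathlib / tree search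

Reused: `VariationalPrincipleLocalKMSRows` (§1 matrix rows `Matrix.IsHermitian.re_gibbsState_eebRow_perturb_ge`,
`…abs_im_gibbsState_commutator_perturb_le`, `…log_partitionFn_add_smul_sum_le`; §2 `apply_evenHermPart_eq`, `isHermitian_evenHermPart`,
`parityAut_evenHermPart`, `fermionEmbed_evenHermPart`, `gibbsState_parityAut_of_parityAut_eq`; §3 `shiftSet_add_subset_halfOpenBox`,
`card_filter_translates_meeting_le`; §4 `fermionEmbed_shiftEmb_trans_incl(_fermionEmbed_incl)`, `commute_fermionEmbed_shiftEmb_trans_incl_of_disjoint`,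
`norm_commutator_fermionEmbed_le`, `FermionInteraction.localHamiltonian_halfOpenBox_commutator_translate`; §7
`Matrix.trace_mul_eq_of_vonNeumannEntropy_eq_log_card`, `FermionInteraction.freePressure_zero`; `InfVolFermionState.expect_commutator_eq_zero_of_localDKMS`),
`VariationalPrincipleBogoliubovInequality` (`Matrix.IsHermitian.re_gibbsState_bogoliubovRow_perturb_ge`), the periodic formalism
(`superlatVec`, `IsPeriodic.shift_superlatVec`, `IsPeriodic.isEven`, `IsPeriodic.tendsto_boxEntropyDensity_mul`,
`IsPeriodic.entropyDensitySup_le_boxEntropyDensity`, `IsPeriodic.abs_pow_mul_cellMeanEnergy_sub_le`, `FermionInteraction.cellSiteNorm`,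
`FermionInteraction.perVarPressure_eq_freePressure`, `InfVolFermionState.dvd_prod_succ`, `IsPerVarEquilibrium`), `FermionInteraction.tendsto_freePressure`,
`FermionInteraction.tendsto_collar_div_pow`, `Matrix.IsHermitian.vonNeumannEntropy_sub_mul_le_log_partitionFn`.

## References

* H. Araki, H. Moriya, *Equilibrium statistical mechanics of fermion lattice systems*, Rev. Math. Phys. 15 (2003) 93–198, Theorem 12.11,
  Def. 6.3, §8 (periodic potentials). [cite: ArakiMoriya2003, Theorem 12.11]
* R. B. Israel, *Convexity in the Theory of Lattice Gases* (1979), Thm. I.2.4, §II.3 (periodic states and tangent functionals).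
  [cite: Israel1979, Thm. I.2.4]
* O. Bratteli, D. W. Robinson, *OAQSM 2* (1997), Thm. 6.2.40 / 6.2.42. [cite: BratteliRobinsonII1997, Thm. 6.2.40]
* F. J. Dyson, E. H. Lieb, B. Simon, J. Stat. Phys. 18 (1978) 335, §2 eq. (28) (Bogoliubov's inequality). [cite: DLS1978, §2 eq. (28)]
* A. Klein, L. J. Landau, D. S. Shucker, J. Stat. Phys. 26 (1981) 505 (Mermin–Wagner for KMS states via Bogoliubov's inequality).
  [cite: KleinLandauShucker1981]
* M. Fannes, A. Verbeure, J. Math. Phys. 19 (1978) 558. [cite: FannesVerbeure1978]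
-/

noncomputable section

open scoped ComplexOrder BigOperators Matrix.Norms.L2Operator
open Finset Literature.InformationTheory.Entropy

namespace Literature.MathematicalPhysics.QuantumLattice

open Matrix Literature.Probability.LatticeModels ThermodynamicLimit
open _root_.Filter
open scoped _root_.Topology

variable {d : ℕ}

/-! ### §1 Superlattice geometry: aligned placements and superlattice translates inside aligned boxes -/

/-- `z ↦ ℓ(z) = ((q_i+1) z_i)_i` is injective. [cite: ArakiMoriya2003, §4.1] -/
theorem superlatVec_injective (q : Fin d → ℕ) : Function.Injective (superlatVec q) := by
  intro z z' h
  funext i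
  have hi := congrFun h i
  rw [superlatVec_apply, superlatVec_apply] at hi
  have hq : ((q i : ℤ) + 1) ≠ 0 := by positivity
  exact mul_right_cancel₀ hq hi

/-- **Superlattice points of an index box lie in the scaled box**: `z ∈ [0,k)^d`, `(q_i+1) ∣ N`, `N ≥ 1` ⇒ `ℓ(z) ∈ [0,kN)^d`.
[cite: ArakiMoriya2003, §4.1] -/
theorem superlatVec_mem_halfOpenBox {q : Fin d → ℕ} {N : ℕ} (hN : 1 ≤ N) (hNq : ∀ i, (q i + 1) ∣ N) {k : ℕ} {z : Site d}
    (hz : z ∈ halfOpenBox d k) : superlatVec q z ∈ halfOpenBox d (k * N) := by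
  rw [mem_halfOpenBox] at hz ⊢
  intro i
  obtain ⟨h0, hk⟩ := hz i
  have hqN : q i + 1 ≤ N := Nat.le_of_dvd (by omega) (hNq i)
  have hqN' : ((q i : ℤ) + 1) ≤ (N : ℤ) := by exact_mod_cast hqN
  rw [superlatVec_apply]
  refine ⟨mul_nonneg h0 (by positivity), ?_⟩
  have h1 : z i + 1 ≤ (k : ℤ) := hk
  push_cast
  nlinarith

/-- **Aligned placement**: every finite region fits, after translation by a SUPERLATTICE vector, in an aligned box:
`Λ + ℓ(z₀) ⊆ [0, w₀N)^d`. [cite: FriedliVelenik2017, §3.2] -/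
theorem exists_superlatVec_shiftSet_subset_halfOpenBox (q : Fin d → ℕ) {N : ℕ} (hN : 1 ≤ N) (Λ : Finset (Site d)) :
    ∃ (z₀ : Fin d → ℤ) (w₀ : ℕ), shiftSet (superlatVec q z₀) Λ ⊆ halfOpenBox d (w₀ * N) := by
  classical
  obtain ⟨B, hB⟩ : ∃ B : ℕ, ∀ x ∈ Λ, ∀ i, (x i).natAbs ≤ B := by
    refine ⟨Λ.sup fun x => Finset.univ.sup fun i => (x i).natAbs, fun x hx i => ?_⟩
    exact (Finset.le_sup (f := fun i => (x i).natAbs) (Finset.mem_univ i)).trans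
      (Finset.le_sup (f := fun x => Finset.univ.sup fun i => (x i).natAbs) hx)
  obtain ⟨Q, hQ⟩ : ∃ Q : ℕ, ∀ i, q i ≤ Q := ⟨Finset.univ.sup q, fun i => Finset.le_sup (Finset.mem_univ i)⟩
  refine ⟨fun _ => (B : ℤ), B * (Q + 2) + 1, fun y hy => ?_⟩
  rw [mem_shiftSet] at hy
  rw [mem_halfOpenBox]
  intro i
  have h := hB _ hy i
  rw [Pi.sub_apply, superlatVec_apply] at h
  have h2 : |y i - (B : ℤ) * ((q i : ℤ) + 1)| ≤ (B : ℤ) := by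
    rw [← Int.natCast_natAbs]; exact_mod_cast h
  obtain ⟨h3, h4⟩ := abs_le.1 h2
  have hqi : (q i : ℤ) ≤ Q := by exact_mod_cast hQ i
  have hN1 : (1 : ℤ) ≤ N := by exact_mod_cast hN
  have hB0 : (0 : ℤ) ≤ B := Int.natCast_nonneg B
  have hq0 : (0 : ℤ) ≤ q i := Int.natCast_nonneg (q i)
  constructor
  · nlinarith
  · push_cast
    have h5 : y i ≤ (B : ℤ) * ((Q : ℤ) + 2) := by nlinarith
    have h6 : ((B : ℤ) * ((Q : ℤ) + 2) + 1) * 1 ≤ ((B : ℤ) * ((Q : ℤ) + 2) + 1) * (N : ℤ) :=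
      mul_le_mul_of_nonneg_left hN1 (by positivity)
    linarith

/-- **Overlap counting for an arbitrary family of offsets**: for fixed `x`, the offsets `u ∈ G` with `(Λ' + u) ∩ (Λ + x) ≠ ∅` number
at most `|Λ|·|Λ'|`. [cite: BratteliRobinsonII1997, §6.2.1] -/
theorem card_filter_offsets_meeting_le (Λ Λ' G : Finset (Site d)) (x : Site d) :
    (G.filter fun u => ¬ Disjoint (shiftSet u Λ') (shiftSet x Λ)).card ≤ Λ.card * Λ'.card := by
  have h := card_filter_translates_meeting_le Λ Λ' G 0 x
  simpa only [add_zero] using h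

/-! ### §2 Translates by an arbitrary family of offsets: invariance of the state, graded locality -/

section Offsets

variable {Λ Λ' : Finset (Site d)} {n : ℕ}

/-- **A state invariant under `τ_u` takes the same value on the interior translate by `u`**: `ω ∘ τ_u = ω ⇒ ω(Γ(ι ∘ τ_u) B) = ω(B)`.
[cite: ArakiMoriya2003, §4.1 Def. 4.5] -/
theorem InfVolFermionState.expect_fermionEmbed_shiftEmb_trans_incl_of_shift_eq {ω : InfVolFermionState d} {u : Site d}
    (hωu : ω.shift u = ω) (hu : shiftSet u Λ' ⊆ halfOpenBox d n) (B : FermionOp Λ') :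
    ω.expect (halfOpenBox d n) (fermionEmbed ((PolySite.shiftEmb u Λ').trans (PolySite.incl hu)) B) = ω.expect Λ' B := by
  rw [fermionEmbed_shiftEmb_trans_incl, ω.compatible hu, ← InfVolFermionState.shift_expect, hωu]

/-- **A periodic state takes the same value on every interior SUPERLATTICE translate**: `ω(Γ(ι ∘ τ_{ℓ(z)}) B) = ω(B)`.
[cite: ArakiMoriya2003, §4.1 Def. 4.5] -/
theorem InfVolFermionState.IsPeriodic.expect_fermionEmbed_shiftEmb_trans_incl {q : Fin d → ℕ} {ω : InfVolFermionState d}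
    (hω : ω.IsPeriodic q) (z : Fin d → ℤ) (hu : shiftSet (superlatVec q z) Λ' ⊆ halfOpenBox d n) (B : FermionOp Λ') :
    ω.expect (halfOpenBox d n) (fermionEmbed ((PolySite.shiftEmb (superlatVec q z) Λ').trans (PolySite.incl hu)) B) = ω.expect Λ' B :=
  InfVolFermionState.expect_fermionEmbed_shiftEmb_trans_incl_of_shift_eq (hω.shift_superlatVec z) hu B

/-- **The perturbation by an arbitrary finite family of interior translates of an even `X` barely fails to commute with a local
observable**: for `Y = Σ_{u ∈ G} Γ(τ_u) X` (`Λ' + u ⊆ [0,n)^d` for `u ∈ G`) and the translate `Ã_x = Γ(τ_x) Γ_{Λ⊆Λ'} A` of `A ∈ 𝔄_Λ`,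
`‖Ã_xᴴ (Y Ã_x − Ã_x Y)‖ ≤ ‖A‖ · |Λ||Λ'| · 2‖X‖‖A‖` — only the `≤ |Λ||Λ'|` translates meeting `Λ + x` contribute (graded locality).
[cite: BratteliRobinsonII1997, §6.2.1] -/
theorem norm_conjTranspose_mul_commutator_sum_offsets_le (hΛ : Λ ⊆ Λ') (A : FermionOp Λ) {X : FermionOp Λ'}
    (hXe : parityAut X = X) {G : Finset (Site d)} (hG : ∀ u ∈ G, shiftSet u Λ' ⊆ halfOpenBox d n) {x : Site d}
    (hx : shiftSet x Λ' ⊆ halfOpenBox d n) :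
    ‖(fermionEmbed ((PolySite.shiftEmb x Λ').trans (PolySite.incl hx)) (fermionEmbed (PolySite.incl hΛ) A))ᴴ *
        ((∑ u ∈ G.attach, fermionEmbed ((PolySite.shiftEmb u.1 Λ').trans (PolySite.incl (hG u.1 u.2))) X) *
            fermionEmbed ((PolySite.shiftEmb x Λ').trans (PolySite.incl hx)) (fermionEmbed (PolySite.incl hΛ) A) -
          fermionEmbed ((PolySite.shiftEmb x Λ').trans (PolySite.incl hx)) (fermionEmbed (PolySite.incl hΛ) A) *
            ∑ u ∈ G.attach, fermionEmbed ((PolySite.shiftEmb u.1 Λ').trans (PolySite.incl (hG u.1 u.2))) X)‖ ≤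
      ‖A‖ * ((Λ.card * Λ'.card : ℕ) * (2 * ‖X‖ * ‖A‖)) := by
  classical
  rw [fermionEmbed_shiftEmb_trans_incl_fermionEmbed_incl hΛ hx A]
  set A' : FermionOp (shiftSet x Λ) := fermionEmbed (PolySite.shiftEmb x Λ) A with hA'
  have hA'n : ‖A'‖ ≤ ‖A‖ := norm_fermionEmbed_le _ A
  have hxΛ : shiftSet x Λ ⊆ halfOpenBox d n := (shiftSet_mono_of_subset x hΛ).trans hx
  set T : G → FermionOp (halfOpenBox d n) := fun u =>
    fermionEmbed ((PolySite.shiftEmb u.1 Λ').trans (PolySite.incl (hG u.1 u.2))) X with hT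
  set a := fermionEmbed (PolySite.incl hxΛ) A' with ha
  have hcomm : (∑ u ∈ G.attach, T u) * a - a * ∑ u ∈ G.attach, T u = ∑ u ∈ G.attach, (T u * a - a * T u) := by
    rw [Finset.sum_mul, Finset.mul_sum, ← Finset.sum_sub_distrib]
  have hterm : ∀ u : G, ‖T u * a - a * T u‖ ≤
      (if ¬ Disjoint (shiftSet u.1 Λ') (shiftSet x Λ) then 2 * ‖X‖ * ‖A'‖ else 0) := by
    intro u
    split_ifs with h
    · rw [(commute_fermionEmbed_shiftEmb_trans_incl_of_disjoint hXe (hG u.1 u.2) hxΛ h A').eq, sub_self, norm_zero]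
    · exact norm_commutator_fermionEmbed_le ((PolySite.shiftEmb u.1 Λ').trans (PolySite.incl (hG u.1 u.2)))
        (PolySite.incl hxΛ) X A'
  have hsum : ‖∑ u ∈ G.attach, (T u * a - a * T u)‖ ≤ (Λ.card * Λ'.card : ℕ) * (2 * ‖X‖ * ‖A'‖) := by
    calc ‖∑ u ∈ G.attach, (T u * a - a * T u)‖ ≤ ∑ u ∈ G.attach, ‖T u * a - a * T u‖ := norm_sum_le _ _
      _ ≤ ∑ u ∈ G.attach, (if ¬ Disjoint (shiftSet u.1 Λ') (shiftSet x Λ) then 2 * ‖X‖ * ‖A'‖ else 0) :=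
          Finset.sum_le_sum fun u _ => hterm u
      _ = ∑ u ∈ G, (if ¬ Disjoint (shiftSet u Λ') (shiftSet x Λ) then 2 * ‖X‖ * ‖A'‖ else 0) :=
          Finset.sum_attach G (fun u => if ¬ Disjoint (shiftSet u Λ') (shiftSet x Λ) then 2 * ‖X‖ * ‖A'‖ else 0)
      _ = ((G.filter fun u => ¬ Disjoint (shiftSet u Λ') (shiftSet x Λ)).card : ℝ) * (2 * ‖X‖ * ‖A'‖) := by
          rw [Finset.sum_ite, Finset.sum_const_zero, add_zero, Finset.sum_const, nsmul_eq_mul]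
      _ ≤ (Λ.card * Λ'.card : ℕ) * (2 * ‖X‖ * ‖A'‖) := by
          refine mul_le_mul_of_nonneg_right ?_ (by positivity)
          exact_mod_cast card_filter_offsets_meeting_le Λ Λ' G x
  rw [hcomm]
  calc ‖aᴴ * ∑ u ∈ G.attach, (T u * a - a * T u)‖ ≤ ‖aᴴ‖ * ‖∑ u ∈ G.attach, (T u * a - a * T u)‖ := norm_mul_le _ _
    _ ≤ ‖A‖ * ((Λ.card * Λ'.card : ℕ) * (2 * ‖X‖ * ‖A'‖)) := by
        refine mul_le_mul ?_ hsum (norm_nonneg _) (norm_nonneg _)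
        rw [ha, Matrix.l2_opNorm_conjTranspose]
        exact (norm_fermionEmbed_le _ _).trans hA'n
    _ ≤ ‖A‖ * ((Λ.card * Λ'.card : ℕ) * (2 * ‖X‖ * ‖A‖)) := by gcongr

/-- A sum of translates of a Hermitian `X` is Hermitian. [cite: BratteliRobinsonII1997, §6.2.1] -/
theorem isHermitian_sum_offsets {X : FermionOp Λ'} (hXh : X.IsHermitian) {G : Finset (Site d)}
    (hG : ∀ u ∈ G, shiftSet u Λ' ⊆ halfOpenBox d n) :
    (∑ u ∈ G.attach, fermionEmbed ((PolySite.shiftEmb u.1 Λ').trans (PolySite.incl (hG u.1 u.2))) X).IsHermitian := by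
  rw [Matrix.IsHermitian, Matrix.conjTranspose_sum]
  refine Finset.sum_congr rfl fun u _ => ?_
  rw [← fermionEmbed_conjTranspose, hXh.eq]

/-- A sum of translates of an even `X` is even (`Θ` commutes with translations). [cite: ArakiMoriya2003, §4.1 Def. 4.3] -/
theorem parityAut_sum_offsets {X : FermionOp Λ'} (hXe : parityAut X = X) {G : Finset (Site d)}
    (hG : ∀ u ∈ G, shiftSet u Λ' ⊆ halfOpenBox d n) :
    parityAut (∑ u ∈ G.attach, fermionEmbed ((PolySite.shiftEmb u.1 Λ').trans (PolySite.incl (hG u.1 u.2))) X) =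
      ∑ u ∈ G.attach, fermionEmbed ((PolySite.shiftEmb u.1 Λ').trans (PolySite.incl (hG u.1 u.2))) X := by
  rw [map_sum]
  refine Finset.sum_congr rfl fun u _ => ?_
  rw [← fermionEmbed_parityAut, hXe]

end Offsets

/-! ### §3 The perturbation principle for periodic equilibrium states -/

/-- Elementary: if `0 ≤ t² C + t r` for every `t > 0` (with `C ≥ 0`) then `0 ≤ r`. [folklore] -/
private theorem nonneg_of_forall_pos_sq_mul_add_mul_nonneg' {C r : ℝ} (hC : 0 ≤ C) (h : ∀ t : ℝ, 0 < t → 0 ≤ t ^ 2 * C + t * r) :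
    0 ≤ r := by
  by_contra hr
  rw [not_le] at hr
  have ht : 0 < -r / (2 * (C + 1)) := div_pos (by linarith) (by linarith)
  have h1 := h _ ht
  have e : (-r / (2 * (C + 1))) ^ 2 * C + -r / (2 * (C + 1)) * r =
      (-r / (2 * (C + 1))) * (r * (C + 2) / (2 * (C + 1))) := by
    field_simp
    ring
  rw [e] at h1
  have h2 : r * (C + 2) / (2 * (C + 1)) < 0 := div_neg_of_neg_of_pos (by nlinarith) (by linarith)
  nlinarith

/-- **A periodic equilibrium state solves the variational principle in the limit form along aligned boxes**: for
`ω.IsPerVarEquilibrium β q Ψ R` (`Ψ` translation covariant, `β ≥ 0`) and every aligned side `N ≥ 1` (`(q_i+1) ∣ N`),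
`S(ω_{[0,kN)^d})/(kN)^d → P_free(β,Ψ) + β ē_q(ω)` as `k → ∞` (`IsPeriodic.tendsto_boxEntropyDensity_mul` and `P_q = P_free`).
[cite: Israel1979, Thm. I.2.4] [cite: BratteliRobinsonII1997, Thm. 6.2.40] -/
theorem InfVolFermionState.IsPerVarEquilibrium.tendsto_boxEntropy_div_mul (hd : 0 < d) {Ψ : FermionInteraction d} {R : ℝ}
    (hH : Ψ.IsHermitian) (hE : Ψ.IsEven) (hT : Ψ.IsTranslationInvariant) (hR : Ψ.HasFiniteRange R) {β : ℝ} (hβ : 0 ≤ β)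
    {q : Fin d → ℕ} {ω : InfVolFermionState d} (h : ω.IsPerVarEquilibrium β q Ψ R) {N : ℕ} (hN : 1 ≤ N)
    (hNq : ∀ i, (q i + 1) ∣ N) :
    Tendsto (fun k : ℕ => vonNeumannEntropy (ω.rdm (halfOpenBox d (k * N))) / (((k * N : ℕ) : ℝ) ^ d)) atTop
      (𝓝 (Ψ.freePressure β + β * InfVolFermionState.cellMeanEnergy q Ψ ω R)) := by
  have h1 := h.1.tendsto_boxEntropyDensity_mul hd hN hNq
  have h2 : ω.entropyDensitySup = Ψ.freePressure β + β * InfVolFermionState.cellMeanEnergy q Ψ ω R := by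
    rw [← Ψ.perVarPressure_eq_freePressure hd hH hE hT hR hβ q]; linarith [h.2]
  rw [← h2]
  exact h1

/-- **THE PERTURBATION PRINCIPLE FOR PERIODIC EQUILIBRIUM STATES, abstract form.** Let `Ψ` be Hermitian, even, translation covariant,
of finite range `R` on `ℤ^d` (`d ≥ 1`), `β ≥ 0`, and `ω` a `q`-periodic equilibrium state (`ω.IsPerVarEquilibrium β q Ψ R`). Let
`X ∈ 𝔄_{Λ'}` be even and Hermitian and `C ≥ 0` a constant such that for every box `[0,n)^d`, every finite family `G` of offsets with
`Λ' + u ⊆ [0,n)^d` (`u ∈ G`), every `u ∈ G` and every `t ≥ 0`, the Gibbs state `ρ_t` of `βH_{[0,n)^d} + tY`, `Y = Σ_{u'∈G} Γ(τ_{u'})X`,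
satisfies `Re ρ_t(Γ(τ_u)X) ≥ −tC` (first-order control, UNIFORM in the volume and the family). Then `Re ω(X) ≥ 0`.
Proof: take for `G` the `k^d` superlattice offsets `ℓ(z) + v`, `z ∈ [0,k)^d`, in the aligned box `[0,(k+w₀)N)^d` (`Λ' + v ⊆ [0,w₀N)^d`,
`v = ℓ(z₀)`); Peierls–Bogoliubov gives `log Z(βH + tY) ≤ log Z(βH) + t²Ck^d`; Gibbs' variational inequality for the box marginal of `ω`
and periodicity (`ω(Γ(τ_{ℓ(z)+v})X) = ω(X)`) give `S(ω_n) ≤ log Z(βH_n + tY) + βRe ω(H_n) + t k^d Re ω(X)`; divide by `n^d = ((k+w₀)N)^d`,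
`k → ∞`: `0 ≤ (t²C + tRe ω(X)) N^{-d}` for every `t > 0`. [cite: ArakiMoriya2003, Theorem 12.11] [cite: Israel1979, Thm. I.2.4] -/
theorem InfVolFermionState.IsPerVarEquilibrium.re_expect_nonneg_of_gibbs_perturbation_const (hd : 0 < d)
    {Ψ : FermionInteraction d} {R : ℝ} (hH : Ψ.IsHermitian) (hE : Ψ.IsEven) (hT : Ψ.IsTranslationInvariant)
    (hR : Ψ.HasFiniteRange R) {β : ℝ} (hβ : 0 ≤ β) {q : Fin d → ℕ} {ω : InfVolFermionState d}
    (h : ω.IsPerVarEquilibrium β q Ψ R) {Λ' : Finset (Site d)} {X : FermionOp Λ'} (hXh : X.IsHermitian) {C : ℝ} (hC0 : 0 ≤ C)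
    (hX : ∀ (n : ℕ) (G : Finset (Site d)) (hG : ∀ u ∈ G, shiftSet u Λ' ⊆ halfOpenBox d n) (u : Site d) (hu : u ∈ G) (t : ℝ),
      0 ≤ t →
        -(t * C) ≤ (gibbsState 1 (((β : ℝ) : ℂ) • Ψ.localHamiltonian (halfOpenBox d n) +
            (t : ℂ) • ∑ u' ∈ G.attach, fermionEmbed ((PolySite.shiftEmb u'.1 Λ').trans (PolySite.incl (hG u'.1 u'.2))) X)
          (fermionEmbed ((PolySite.shiftEmb u Λ').trans (PolySite.incl (hG u hu))) X)).re) :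
    0 ≤ (ω.expect Λ' X).re := by
  classical
  have hω : ω.IsPeriodic q := h.1
  -- an aligned side `N` and an aligned placement `Λ' + v ⊆ [0, w₀N)^d`, `v` a superlattice vector
  obtain ⟨N, hN1, hNq⟩ : ∃ N : ℕ, 1 ≤ N ∧ ∀ i, (q i + 1) ∣ N :=
    ⟨∏ i, (q i + 1), Finset.prod_pos fun i _ => Nat.succ_pos _, InfVolFermionState.dvd_prod_succ q⟩
  obtain ⟨z₀, w₀, hv⟩ := exists_superlatVec_shiftSet_subset_halfOpenBox q hN1 Λ'
  set v : Site d := superlatVec q z₀ with hvdef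
  set r : ℝ := (ω.expect Λ' X).re with hr
  set e : ℝ := InfVolFermionState.cellMeanEnergy q Ψ ω R with he
  set P : ℝ := Ψ.freePressure β with hP
  set SΨ : ℝ := Ψ.cellSiteNorm q R with hSΨ
  set c0 : ℝ := ((Ψ.Φ ∅) ∅ ∅).re with hc0
  set L : ℝ := (1 / (N : ℝ)) ^ d with hL
  have hLpos : 0 < L := by rw [hL]; positivity
  -- the superlattice offsets `ℓ(z) + v`, `z ∈ [0,k)^d`, put `Λ'` inside `[0, kN + w₀N)^d`
  have hGsub : ∀ (k : ℕ), ∀ u ∈ (halfOpenBox d k).image (fun z => superlatVec q z + v),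
      shiftSet u Λ' ⊆ halfOpenBox d (k * N + w₀ * N) := by
    intro k u hu
    obtain ⟨z, hz, rfl⟩ := Finset.mem_image.1 hu
    exact shiftSet_add_subset_halfOpenBox hv (superlatVec_mem_halfOpenBox hN1 hNq hz)
  have hshift : ∀ (k : ℕ), ∀ u ∈ (halfOpenBox d k).image (fun z => superlatVec q z + v), ω.shift u = ω := by
    intro k u hu
    obtain ⟨z, _, rfl⟩ := Finset.mem_image.1 hu
    rw [hvdef, ← superlatVec_add]
    exact hω.shift_superlatVec _
  have hinj : Function.Injective (fun z : Site d => superlatVec q z + v) :=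
    fun z z' hz => superlatVec_injective q (add_right_cancel hz)
  have hcardG : ∀ k : ℕ, ((((halfOpenBox d k).image (fun z => superlatVec q z + v)).card : ℕ) : ℝ) = (k : ℝ) ^ d := by
    intro k
    rw [Finset.card_image_of_injective _ hinj, card_halfOpenBox]
    push_cast
    ring
  /- STEP 1: the finite-volume inequality in the aligned box `[0, kN + w₀N)^d`, for every `k` and every `t ≥ 0`. -/
  have key : ∀ (k : ℕ) (t : ℝ), 0 ≤ t →
      vonNeumannEntropy (ω.rdm (halfOpenBox d (k * N + w₀ * N))) ≤
        Real.log (partitionFn β (Ψ.localHamiltonian (halfOpenBox d (k * N + w₀ * N)))).re + t ^ 2 * C * (k : ℝ) ^ d +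
          β * (ω.expect (halfOpenBox d (k * N + w₀ * N)) (Ψ.localHamiltonian (halfOpenBox d (k * N + w₀ * N)))).re +
            t * (k : ℝ) ^ d * r := by
    intro k t ht
    set G := (halfOpenBox d k).image (fun z => superlatVec q z + v) with hG
    have hGs : ∀ u ∈ G, shiftSet u Λ' ⊆ halfOpenBox d (k * N + w₀ * N) := hGsub k
    set K := Ψ.localHamiltonian (halfOpenBox d (k * N + w₀ * N)) with hK
    set T : G → FermionOp (halfOpenBox d (k * N + w₀ * N)) := fun u =>
      fermionEmbed ((PolySite.shiftEmb u.1 Λ').trans (PolySite.incl (hGs u.1 u.2))) X with hTdef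
    have hKh : K.IsHermitian := FermionInteraction.localHamiltonian_isHermitian hH _
    have hYh : (∑ u ∈ G.attach, T u).IsHermitian := isHermitian_sum_offsets hXh hGs
    have hβK : (((β : ℝ) : ℂ) • K).IsHermitian := by
      rw [Matrix.IsHermitian, conjTranspose_smul, hKh.eq]; simp only [Complex.star_def, Complex.conj_ofReal]
    have hHh : (((β : ℝ) : ℂ) • K + (t : ℂ) • ∑ u ∈ G.attach, T u).IsHermitian := by
      refine hβK.add ?_
      rw [Matrix.IsHermitian, conjTranspose_smul, hYh.eq]; simp only [Complex.star_def, Complex.conj_ofReal]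
    -- (ii) first-order control of every translate in the perturbed Gibbs state
    have hlow : ∀ u ∈ G.attach, -(t * C) ≤ (gibbsState 1 (((β : ℝ) : ℂ) • K + (t : ℂ) • ∑ u ∈ G.attach, T u) (T u)).re :=
      fun u _ => hX (k * N + w₀ * N) G hGs u.1 u.2 t ht
    -- (iii) second-order pressure bound
    have hZ := hβK.log_partitionFn_add_smul_sum_le hYh ht hlow
    have hcardG' : ((G.attach.card : ℕ) : ℝ) = (k : ℝ) ^ d := by rw [Finset.card_attach, hG]; exact hcardG k
    rw [hcardG', partitionFn_one_real_smul] at hZ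
    -- (iv) the Gibbs variational inequality for the box marginal of `ω`
    have hGibbs := hHh.vonNeumannEntropy_sub_mul_le_log_partitionFn 1 (ω.rdm_posSemidef _) (ω.trace_rdm _)
    rw [trace_rdm_mul, one_mul, map_add, map_smul, map_smul, map_sum, Complex.add_re, smul_eq_mul, smul_eq_mul,
      Complex.re_ofReal_mul, Complex.re_ofReal_mul, Complex.re_sum] at hGibbs
    -- (v) periodicity: every superlattice translate has expectation `Re ω(X)`
    have hsum : ∑ u ∈ G.attach, (ω.expect (halfOpenBox d (k * N + w₀ * N)) (T u)).re = (k : ℝ) ^ d * r := by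
      have hterm : ∀ u ∈ G.attach, (ω.expect (halfOpenBox d (k * N + w₀ * N)) (T u)).re = r := fun u _ => by
        show (ω.expect _ (fermionEmbed _ X)).re = r
        rw [InfVolFermionState.expect_fermionEmbed_shiftEmb_trans_incl_of_shift_eq (hshift k u.1 u.2)]
      rw [Finset.sum_congr rfl hterm, Finset.sum_const, nsmul_eq_mul, hcardG']
    rw [hsum] at hGibbs
    nlinarith [hGibbs, hZ, sq_nonneg t]
  /- STEP 2: the energy of an aligned box is `n^d ē_q(ω)` up to a collar. -/
  have hdvd : ∀ (k : ℕ) (i : Fin d), (q i + 1) ∣ k * N + w₀ * N := fun k i =>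
    (Dvd.dvd.mul_left (hNq i) k).add (Dvd.dvd.mul_left (hNq i) w₀)
  have energy : ∀ k : ℕ,
      (ω.expect (halfOpenBox d (k * N + w₀ * N)) (Ψ.localHamiltonian (halfOpenBox d (k * N + w₀ * N)))).re ≤
        (((k * N + w₀ * N : ℕ) : ℝ)) ^ d * e + c0 +
          ((thicken (halfOpenBox d (k * N + w₀ * N)) R \ halfOpenBox d (k * N + w₀ * N)).card : ℝ) * SΨ := by
    intro k
    have h := hω.abs_pow_mul_cellMeanEnergy_sub_le (hT.isPeriodic q) hR
      (fun y => (hT.isPeriodic q).site_norm_le_cellSiteNorm R y) (hdvd k)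
    have h' := (abs_le.1 h).1
    linarith
  /- STEP 3: divide by `n^d`, `n = kN + w₀N`, and pass to the limit `k → ∞`. -/
  have hmul : Tendsto (fun k : ℕ => k * N + w₀ * N) atTop atTop :=
    tendsto_atTop_mono (fun k => (Nat.le_mul_of_pos_right k hN1).trans (Nat.le_add_right _ _)) tendsto_id
  have hpow0 : Tendsto (fun n : ℕ => ((n : ℝ) ^ d)) atTop atTop := by
    have h := (tendsto_natCast_atTop_atTop (R := ℝ)).comp (tendsto_pow_atTop (α := ℕ) (ne_of_gt hd))
    refine h.congr fun n => ?_
    simp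
  have hpow : Tendsto (fun k : ℕ => (((k * N + w₀ * N : ℕ) : ℝ) ^ d)) atTop atTop := hpow0.comp hmul
  have hSlim : Tendsto (fun k : ℕ => vonNeumannEntropy (ω.rdm (halfOpenBox d (k * N + w₀ * N))) /
      (((k * N + w₀ * N : ℕ) : ℝ) ^ d)) atTop (𝓝 (P + β * e)) := by
    have h1 := (h.tendsto_boxEntropy_div_mul hd hH hE hT hR hβ hN1 hNq).comp (tendsto_add_atTop_nat w₀)
    refine h1.congr fun k => ?_
    show vonNeumannEntropy (ω.rdm (halfOpenBox d ((k + w₀) * N))) / ((((k + w₀) * N : ℕ) : ℝ) ^ d) = _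
    rw [Nat.add_mul]
  have hZlim : Tendsto (fun k : ℕ => Real.log (partitionFn β (Ψ.localHamiltonian (halfOpenBox d (k * N + w₀ * N)))).re /
      (((k * N + w₀ * N : ℕ) : ℝ) ^ d)) atTop (𝓝 P) := (Ψ.tendsto_freePressure hd hH hE hT hR hβ).comp hmul
  have hcol : Tendsto (fun k : ℕ => (((thicken (halfOpenBox d (k * N + w₀ * N)) R \ halfOpenBox d (k * N + w₀ * N)).card : ℝ)) /
      (((k * N + w₀ * N : ℕ) : ℝ) ^ d)) atTop (𝓝 0) := (FermionInteraction.tendsto_collar_div_pow hd R).comp hmul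
  have hc0lim : Tendsto (fun k : ℕ => c0 / (((k * N + w₀ * N : ℕ) : ℝ) ^ d)) atTop (𝓝 0) := tendsto_const_nhds.div_atTop hpow
  have hratio : Tendsto (fun k : ℕ => ((k : ℝ) ^ d) / (((k * N + w₀ * N : ℕ) : ℝ) ^ d)) atTop (𝓝 L) := by
    have h := ((tendsto_natCast_div_add_atTop (w₀ : ℝ)).div_const (N : ℝ)).pow d
    rw [hL]
    refine h.congr fun k => ?_
    rw [div_div, ← div_pow]
    congr 1
    push_cast
    ring
  -- for every `t > 0`: `0 ≤ (t²C + t·r) L`, hence `0 ≤ t²C + t·r`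
  have hfin : ∀ t : ℝ, 0 < t → 0 ≤ t ^ 2 * C + t * r := by
    intro t ht
    have hLim : Tendsto (fun k : ℕ => vonNeumannEntropy (ω.rdm (halfOpenBox d (k * N + w₀ * N))) / (((k * N + w₀ * N : ℕ) : ℝ) ^ d) -
        Real.log (partitionFn β (Ψ.localHamiltonian (halfOpenBox d (k * N + w₀ * N)))).re / (((k * N + w₀ * N : ℕ) : ℝ) ^ d) -
        β * (e + (c0 / (((k * N + w₀ * N : ℕ) : ℝ) ^ d) +
          (((thicken (halfOpenBox d (k * N + w₀ * N)) R \ halfOpenBox d (k * N + w₀ * N)).card : ℝ)) /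
            (((k * N + w₀ * N : ℕ) : ℝ) ^ d) * SΨ)))
        atTop (𝓝 (P + β * e - P - β * (e + (0 + 0 * SΨ)))) :=
      (hSlim.sub hZlim).sub (((hc0lim.add (hcol.mul_const SΨ)).const_add e).const_mul β)
    rw [show P + β * e - P - β * (e + (0 + 0 * SΨ)) = 0 by ring] at hLim
    have hU : Tendsto (fun k : ℕ => (t ^ 2 * C + t * r) * (((k : ℝ) ^ d) / (((k * N + w₀ * N : ℕ) : ℝ) ^ d))) atTop
        (𝓝 ((t ^ 2 * C + t * r) * L)) := hratio.const_mul _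
    have hev : ∀ k : ℕ, 1 ≤ k →
        vonNeumannEntropy (ω.rdm (halfOpenBox d (k * N + w₀ * N))) / (((k * N + w₀ * N : ℕ) : ℝ) ^ d) -
          Real.log (partitionFn β (Ψ.localHamiltonian (halfOpenBox d (k * N + w₀ * N)))).re / (((k * N + w₀ * N : ℕ) : ℝ) ^ d) -
          β * (e + (c0 / (((k * N + w₀ * N : ℕ) : ℝ) ^ d) +
            (((thicken (halfOpenBox d (k * N + w₀ * N)) R \ halfOpenBox d (k * N + w₀ * N)).card : ℝ)) /
              (((k * N + w₀ * N : ℕ) : ℝ) ^ d) * SΨ)) ≤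
        (t ^ 2 * C + t * r) * (((k : ℝ) ^ d) / (((k * N + w₀ * N : ℕ) : ℝ) ^ d)) := by
      intro k hk
      have hn1 : 1 ≤ k * N + w₀ * N := le_add_right (Nat.one_le_iff_ne_zero.2 (Nat.mul_ne_zero (by omega) (by omega)))
      have hnd : (0 : ℝ) < ((k * N + w₀ * N : ℕ) : ℝ) ^ d := pow_pos (by exact_mod_cast hn1) d
      have hk' := key k t ht.le
      have hen := mul_le_mul_of_nonneg_left (energy k) hβ
      rw [sub_sub, sub_le_iff_le_add, div_le_iff₀ hnd]
      have e1 : ((t ^ 2 * C + t * r) * ((k : ℝ) ^ d / ((k * N + w₀ * N : ℕ) : ℝ) ^ d) +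
          (Real.log (partitionFn β (Ψ.localHamiltonian (halfOpenBox d (k * N + w₀ * N)))).re / ((k * N + w₀ * N : ℕ) : ℝ) ^ d +
            β * (e + (c0 / ((k * N + w₀ * N : ℕ) : ℝ) ^ d +
              ((thicken (halfOpenBox d (k * N + w₀ * N)) R \ halfOpenBox d (k * N + w₀ * N)).card : ℝ) /
                ((k * N + w₀ * N : ℕ) : ℝ) ^ d * SΨ)))) * ((k * N + w₀ * N : ℕ) : ℝ) ^ d =
          (t ^ 2 * C + t * r) * (k : ℝ) ^ d + Real.log (partitionFn β (Ψ.localHamiltonian (halfOpenBox d (k * N + w₀ * N)))).re +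
            β * (((k * N + w₀ * N : ℕ) : ℝ) ^ d * e + c0 +
              ((thicken (halfOpenBox d (k * N + w₀ * N)) R \ halfOpenBox d (k * N + w₀ * N)).card : ℝ) * SΨ) := by
        field_simp
        ring
      rw [e1]
      nlinarith [hk', hen]
    have hle := le_of_tendsto_of_tendsto hLim hU (Filter.eventually_atTop.2 ⟨1, hev⟩)
    exact (mul_nonneg_iff_of_pos_right hLpos).1 hle
  exact nonneg_of_forall_pos_sq_mul_add_mul_nonneg' hC0 hfin

/-- **THE PERTURBATION PRINCIPLE FOR PERIODIC EQUILIBRIUM STATES (graded-locality instance).** Let `Ψ` be Hermitian, even,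
translation covariant, of finite range `R` on `ℤ^d` (`d ≥ 1`), `β ≥ 0`, `ω.IsPerVarEquilibrium β q Ψ R`. Let `X ∈ 𝔄_{Λ'}` be even and
Hermitian, `A ∈ 𝔄_Λ`, `Λ ⊆ Λ'`, and suppose that for every box `[0,n)^d ⊇ Λ' + u`, every even Hermitian `Y` on the box and every
`t ≥ 0` the Gibbs state `ρ_t` of `βH_{[0,n)^d} + tY` satisfies `Re ρ_t(Γ(ι∘τ_u) X) ≥ −t‖Ã_uᴴ(YÃ_u − Ã_uY)‖` (`Ã_u = Γ(ι∘τ_u)Γ_{Λ⊆Λ'}A`).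
Then `Re ω(X) ≥ 0` (the same hypothesis as `IsTranslationInvariant.re_expect_nonneg_of_gibbs_perturbation`; graded locality of the
family of superlattice translates, `norm_conjTranspose_mul_commutator_sum_offsets_le`, supplies the volume-independent constant).
[cite: ArakiMoriya2003, Theorem 12.11] [cite: Israel1979, Thm. I.2.4] -/
theorem InfVolFermionState.IsPerVarEquilibrium.re_expect_nonneg_of_gibbs_perturbation (hd : 0 < d)
    {Ψ : FermionInteraction d} {R : ℝ} (hH : Ψ.IsHermitian) (hE : Ψ.IsEven) (hT : Ψ.IsTranslationInvariant)
    (hR : Ψ.HasFiniteRange R) {β : ℝ} (hβ : 0 ≤ β) {q : Fin d → ℕ} {ω : InfVolFermionState d}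
    (h : ω.IsPerVarEquilibrium β q Ψ R) {Λ Λ' : Finset (Site d)} (hΛ : Λ ⊆ Λ') (A : FermionOp Λ) {X : FermionOp Λ'}
    (hXh : X.IsHermitian) (hXe : parityAut X = X)
    (hX : ∀ (n : ℕ) (u : Site d) (hu : shiftSet u Λ' ⊆ halfOpenBox d n) (Y : FermionOp (halfOpenBox d n)),
      Y.IsHermitian → parityAut Y = Y → ∀ t : ℝ, 0 ≤ t →
        -(t * ‖(fermionEmbed ((PolySite.shiftEmb u Λ').trans (PolySite.incl hu)) (fermionEmbed (PolySite.incl hΛ) A))ᴴ *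
              (Y * fermionEmbed ((PolySite.shiftEmb u Λ').trans (PolySite.incl hu)) (fermionEmbed (PolySite.incl hΛ) A) -
                fermionEmbed ((PolySite.shiftEmb u Λ').trans (PolySite.incl hu)) (fermionEmbed (PolySite.incl hΛ) A) * Y)‖) ≤
          (gibbsState 1 (((β : ℝ) : ℂ) • Ψ.localHamiltonian (halfOpenBox d n) + (t : ℂ) • Y)
            (fermionEmbed ((PolySite.shiftEmb u Λ').trans (PolySite.incl hu)) X)).re) :
    0 ≤ (ω.expect Λ' X).re := by
  classical
  refine h.re_expect_nonneg_of_gibbs_perturbation_const hd hH hE hT hR hβ hXh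
    (C := ‖A‖ * ((Λ.card * Λ'.card : ℕ) * (2 * ‖X‖ * ‖A‖))) (by positivity) fun n G hG u hu t ht => ?_
  have h1 := hX n u (hG u hu) _ (isHermitian_sum_offsets hXh hG) (parityAut_sum_offsets hXe hG) t ht
  have h2 := mul_le_mul_of_nonneg_left (norm_conjTranspose_mul_commutator_sum_offsets_le hΛ A hXe hG (hG u hu)) ht
  linarith

/-! ### §4 The local KMS rows of a periodic equilibrium state: `(C-2)`, `(C-1)`, stationarity -/

section Rows

variable (hd : 0 < d) {Ψ : FermionInteraction d} {R : ℝ} (hH : Ψ.IsHermitian) (hE : Ψ.IsEven)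
  (hT : Ψ.IsTranslationInvariant) (hR : Ψ.HasFiniteRange R) {β : ℝ} (hβ : 0 ≤ β) {q : Fin d → ℕ} {ω : InfVolFermionState d}
include hd hH hE hT hR hβ

/-- **`(C-2)` FOR PERIODIC EQUILIBRIUM STATES**: every `q`-periodic equilibrium state of `(β, Ψ)` (`β ≥ 0`, `Ψ` Hermitian even
translation covariant of finite range `R`, `d ≥ 1`) satisfies every local energy–entropy balance row: for `Λ' ⊇ thicken Λ R`,
`A ∈ 𝔄_Λ` (charged or not), `e^{s−1} ≤ q'`: `0 ≤ Re ω(β Ãᴴ(H_{Λ'}Ã − ÃH_{Λ'}) − s ÃᴴÃ + q' ÃÃᴴ)`, `Ã = Γ_{Λ⊆Λ'}A`.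
[cite: ArakiMoriya2003, Theorem 12.11] [cite: Israel1979, Thm. I.2.4] [cite: FawziFawziScalet2024, arXiv §3.1 Thm 3.1 (5)] -/
theorem InfVolFermionState.IsPerVarEquilibrium.re_expect_eebRow_nonneg (h : ω.IsPerVarEquilibrium β q Ψ R)
    {Λ Λ' : Finset (Site d)} (hΛR : thicken Λ R ⊆ Λ') (A : FermionOp Λ) {s q' : ℝ} (hq : Real.exp (s - 1) ≤ q') :
    0 ≤ (ω.expect Λ'
      (((β : ℝ) : ℂ) • ((fermionEmbed (PolySite.incl ((subset_thicken Λ R).trans hΛR)) A)ᴴ *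
          (Ψ.localHamiltonian Λ' * fermionEmbed (PolySite.incl ((subset_thicken Λ R).trans hΛR)) A -
            fermionEmbed (PolySite.incl ((subset_thicken Λ R).trans hΛR)) A * Ψ.localHamiltonian Λ')) -
        ((s : ℝ) : ℂ) • ((fermionEmbed (PolySite.incl ((subset_thicken Λ R).trans hΛR)) A)ᴴ *
          fermionEmbed (PolySite.incl ((subset_thicken Λ R).trans hΛR)) A) +
        ((q' : ℝ) : ℂ) • (fermionEmbed (PolySite.incl ((subset_thicken Λ R).trans hΛR)) A *
          (fermionEmbed (PolySite.incl ((subset_thicken Λ R).trans hΛR)) A)ᴴ))).re := by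
  classical
  set a := fermionEmbed (PolySite.incl ((subset_thicken Λ R).trans hΛR)) A with ha
  set M : FermionOp Λ' := ((β : ℝ) : ℂ) • (aᴴ * (Ψ.localHamiltonian Λ' * a - a * Ψ.localHamiltonian Λ')) -
    ((s : ℝ) : ℂ) • (aᴴ * a) + ((q' : ℝ) : ℂ) • (a * aᴴ) with hM
  set X : FermionOp Λ' := (2 : ℂ)⁻¹ • ((2 : ℂ)⁻¹ • (M + Mᴴ) + parityAut ((2 : ℂ)⁻¹ • (M + Mᴴ))) with hXdef
  have hωX : ω.expect Λ' X = ((ω.expect Λ' M).re : ℂ) :=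
    apply_evenHermPart_eq (ω.expect_conjTranspose Λ') ((h.1.isEven hd) Λ') M
  have hre : (ω.expect Λ' M).re = (ω.expect Λ' X).re := by rw [hωX, Complex.ofReal_re]
  rw [hre]
  refine h.re_expect_nonneg_of_gibbs_perturbation hd hH hE hT hR hβ ((subset_thicken Λ R).trans hΛR) A
    (isHermitian_evenHermPart M) (parityAut_evenHermPart M) fun n u hu Y hYh hYe t ht => ?_
  -- the finite-volume row
  set Kn := Ψ.localHamiltonian (halfOpenBox d n) with hKn
  have hKh : Kn.IsHermitian := FermionInteraction.localHamiltonian_isHermitian hH _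
  have hKe : parityAut Kn = Kn := FermionInteraction.parityAut_localHamiltonian hE _
  have hH₀ : (((β : ℝ) : ℂ) • Kn).IsHermitian := by
    rw [Matrix.IsHermitian, conjTranspose_smul, hKh.eq]; simp only [Complex.star_def, Complex.conj_ofReal]
  have hHt : (((β : ℝ) : ℂ) • Kn + (t : ℂ) • Y).IsHermitian := by
    refine hH₀.add ?_
    rw [Matrix.IsHermitian, conjTranspose_smul, hYh.eq]; simp only [Complex.star_def, Complex.conj_ofReal]
  have hHe : parityAut (((β : ℝ) : ℂ) • Kn + (t : ℂ) • Y) = ((β : ℝ) : ℂ) • Kn + (t : ℂ) • Y := by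
    rw [map_add, map_smul, map_smul, hKe, hYe]
  set Tu := fermionEmbed ((PolySite.shiftEmb u Λ').trans (PolySite.incl hu)) with hTu
  -- the translate of the row operator is the row operator of the translate, against `βK_n`
  have hloc := Ψ.localHamiltonian_halfOpenBox_commutator_translate hE hT hR hΛR hu A
  have hTM : Tu M = (Tu a)ᴴ * ((((β : ℝ) : ℂ) • Kn) * Tu a - Tu a * (((β : ℝ) : ℂ) • Kn)) -
      ((s : ℝ) : ℂ) • ((Tu a)ᴴ * Tu a) + ((q' : ℝ) : ℂ) • (Tu a * (Tu a)ᴴ) := by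
    rw [hM, map_add, map_sub, map_smul, map_smul, map_smul, map_mul, map_mul, map_mul, ← hloc, fermionEmbed_conjTranspose,
      Matrix.smul_mul, Matrix.mul_smul, ← smul_sub, Matrix.mul_smul]
  have hgX : gibbsState 1 (((β : ℝ) : ℂ) • Kn + (t : ℂ) • Y) (Tu X) =
      (((gibbsState 1 (((β : ℝ) : ℂ) • Kn + (t : ℂ) • Y) (Tu M)).re : ℂ)) := by
    rw [hXdef, fermionEmbed_evenHermPart]
    exact apply_evenHermPart_eq (fun B => gibbsState_conjTranspose 1 hHt B)
      (fun B => gibbsState_parityAut_of_parityAut_eq hHe 1 B) (Tu M)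
  rw [hgX, Complex.ofReal_re, hTM]
  have h' := hH₀.re_gibbsState_eebRow_perturb_ge hYh t (Tu a) hq
  rw [abs_of_nonneg ht] at h'
  exact h'

/-- **`(C-1)` for periodic equilibrium states at `β > 0`**: `Im ω(Ãᴴ(H_{Λ'}Ã − ÃH_{Λ'})) = 0` for every local `A`
(charged or not). [cite: ArakiMoriya2003, Theorem 12.11] -/
theorem InfVolFermionState.IsPerVarEquilibrium.im_expect_conjTranspose_mul_commutator_eq_zero_of_pos (h : ω.IsPerVarEquilibrium β q Ψ R)
    (hβ0 : 0 < β) {Λ Λ' : Finset (Site d)} (hΛR : thicken Λ R ⊆ Λ') (A : FermionOp Λ) :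
    (ω.expect Λ' ((fermionEmbed (PolySite.incl ((subset_thicken Λ R).trans hΛR)) A)ᴴ *
      (Ψ.localHamiltonian Λ' * fermionEmbed (PolySite.incl ((subset_thicken Λ R).trans hΛR)) A -
        fermionEmbed (PolySite.incl ((subset_thicken Λ R).trans hΛR)) A * Ψ.localHamiltonian Λ'))).im = 0 := by
  classical
  set a := fermionEmbed (PolySite.incl ((subset_thicken Λ R).trans hΛR)) A with ha
  set B : FermionOp Λ' := aᴴ * (Ψ.localHamiltonian Λ' * a - a * Ψ.localHamiltonian Λ') with hB
  -- for each sign `σ = ±1`: `0 ≤ σ · β · Im ω(B)`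
  have hsign : ∀ σ : ℝ, σ = 1 ∨ σ = -1 → 0 ≤ σ * (β * (ω.expect Λ' B).im) := by
    intro σ hσ
    set M : FermionOp Λ' := ((σ : ℝ) : ℂ) • ((-Complex.I) • (((β : ℝ) : ℂ) • B)) with hM
    set X : FermionOp Λ' := (2 : ℂ)⁻¹ • ((2 : ℂ)⁻¹ • (M + Mᴴ) + parityAut ((2 : ℂ)⁻¹ • (M + Mᴴ))) with hXdef
    have hreM : ∀ (φ : FermionOp Λ' →ₗ[ℂ] ℂ), (φ M).re = σ * (β * (φ B).im) := by
      intro φ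
      rw [hM, map_smul, map_smul, map_smul, smul_eq_mul, smul_eq_mul, smul_eq_mul, Complex.re_ofReal_mul]
      congr 1
      simp only [Complex.mul_re, Complex.mul_im, Complex.neg_re, Complex.neg_im, Complex.I_re, Complex.I_im,
        Complex.ofReal_re, Complex.ofReal_im]
      ring
    have hωX : ω.expect Λ' X = ((ω.expect Λ' M).re : ℂ) :=
      apply_evenHermPart_eq (ω.expect_conjTranspose Λ') ((h.1.isEven hd) Λ') M
    rw [← hreM, show (ω.expect Λ' M).re = (ω.expect Λ' X).re by rw [hωX, Complex.ofReal_re]]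
    refine h.re_expect_nonneg_of_gibbs_perturbation hd hH hE hT hR hβ ((subset_thicken Λ R).trans hΛR) A
      (isHermitian_evenHermPart M) (parityAut_evenHermPart M) fun n u hu Y hYh hYe t ht => ?_
    set Kn := Ψ.localHamiltonian (halfOpenBox d n) with hKn
    have hKh : Kn.IsHermitian := FermionInteraction.localHamiltonian_isHermitian hH _
    have hKe : parityAut Kn = Kn := FermionInteraction.parityAut_localHamiltonian hE _
    have hH₀ : (((β : ℝ) : ℂ) • Kn).IsHermitian := by
      rw [Matrix.IsHermitian, conjTranspose_smul, hKh.eq]; simp only [Complex.star_def, Complex.conj_ofReal]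
    have hHt : (((β : ℝ) : ℂ) • Kn + (t : ℂ) • Y).IsHermitian := by
      refine hH₀.add ?_
      rw [Matrix.IsHermitian, conjTranspose_smul, hYh.eq]; simp only [Complex.star_def, Complex.conj_ofReal]
    have hHe : parityAut (((β : ℝ) : ℂ) • Kn + (t : ℂ) • Y) = ((β : ℝ) : ℂ) • Kn + (t : ℂ) • Y := by
      rw [map_add, map_smul, map_smul, hKe, hYe]
    set Tu := fermionEmbed ((PolySite.shiftEmb u Λ').trans (PolySite.incl hu)) with hTu
    have hloc := Ψ.localHamiltonian_halfOpenBox_commutator_translate hE hT hR hΛR hu A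
    have hTB : Tu (((β : ℝ) : ℂ) • B) = (Tu a)ᴴ * ((((β : ℝ) : ℂ) • Kn) * Tu a - Tu a * (((β : ℝ) : ℂ) • Kn)) := by
      rw [hB, map_smul, map_mul, ← hloc, fermionEmbed_conjTranspose, Matrix.smul_mul, Matrix.mul_smul, ← smul_sub,
        Matrix.mul_smul]
    have hgX : gibbsState 1 (((β : ℝ) : ℂ) • Kn + (t : ℂ) • Y) (Tu X) =
        (((gibbsState 1 (((β : ℝ) : ℂ) • Kn + (t : ℂ) • Y) (Tu M)).re : ℂ)) := by
      rw [hXdef, fermionEmbed_evenHermPart]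
      exact apply_evenHermPart_eq (fun B => gibbsState_conjTranspose 1 hHt B)
        (fun B => gibbsState_parityAut_of_parityAut_eq hHe 1 B) (Tu M)
    rw [hgX, Complex.ofReal_re]
    have hre : (gibbsState 1 (((β : ℝ) : ℂ) • Kn + (t : ℂ) • Y) (Tu M)).re =
        σ * (gibbsState 1 (((β : ℝ) : ℂ) • Kn + (t : ℂ) • Y) ((Tu a)ᴴ *
          ((((β : ℝ) : ℂ) • Kn) * Tu a - Tu a * (((β : ℝ) : ℂ) • Kn)))).im := by
      have h1 := hreM ((gibbsState 1 (((β : ℝ) : ℂ) • Kn + (t : ℂ) • Y)).comp Tu.toLinearMap)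
      simp only [LinearMap.comp_apply, AlgHom.toLinearMap_apply] at h1
      rw [h1, ← hTB, map_smul, map_smul, smul_eq_mul, Complex.im_ofReal_mul]
    rw [hre]
    have h' := hH₀.abs_im_gibbsState_commutator_perturb_le hYh t (Tu a)
    rw [abs_of_nonneg ht] at h'
    have h'' := abs_le.1 h'
    rcases hσ with rfl | rfl
    · linarith [h''.1]
    · linarith [h''.2]
  have h1 := hsign 1 (Or.inl rfl)
  have h2 := hsign (-1) (Or.inr rfl)
  have hβim : β * (ω.expect Λ' B).im = 0 := by linarith
  rcases mul_eq_zero.1 hβim with h0 | h0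
  · exact absurd h0 hβ0.ne'
  · exact h0

end Rows

/-! #### `β = 0`: a periodic state of maximal entropy density is tracial on every aligned box -/

section InfiniteTemperature

/-- The imaginary part of the trace of a Hermitian matrix vanishes. [folklore] -/
private theorem im_trace_eq_zero_of_isHermitian' {m : Type*} [Fintype m] {H : Matrix m m ℂ} (hH : H.IsHermitian) :
    H.trace.im = 0 := by
  have h := Matrix.trace_conjTranspose H
  rw [hH.eq, Complex.star_def] at h
  exact Complex.conj_eq_iff_im.1 h.symm

/-- The Fock space of a region with `k` sites has dimension `4^k`: `log dim = 2 k log 2`. [folklore] -/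
private theorem log_card_fock_polySite' (Λ : Finset (Site d)) :
    Real.log (Fintype.card (Finset (Orb (PolySite Λ)))) = 2 * (Λ.card : ℝ) * Real.log 2 := by
  have hc : (lexSites Λ).card = Λ.card := by rw [lexSites, Finset.card_map]
  rw [Fintype.card_finset, Fintype.card_lex, Fintype.card_prod, Fintype.card_fin, Fintype.card_coe, hc]
  push_cast
  rw [Real.log_pow]
  push_cast
  ring

/-- **A periodic state of maximal entropy density is the trace state on every ALIGNED box**: if `ω` is `q`-periodic with
`s̄(ω) = 2 log 2` then `ω(B) = tr(B)/dim` for every `B ∈ 𝔄_{[0,m)^d}`, `m ≥ 1`, `(q_i+1) ∣ m` (`s̄ ≤ S_m/m^d ≤ 2 log 2`,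
`IsPeriodic.entropyDensitySup_le_boxEntropyDensity`, forces `S(ω_{[0,m)^d}) = log dim`). [cite: ArakiMoriya2003, Theorem 3.8 and §10] -/
theorem InfVolFermionState.IsPeriodic.expect_eq_trace_div_of_entropy_max (hd : 0 < d) {q : Fin d → ℕ} {ω : InfVolFermionState d}
    (hω : ω.IsPeriodic q) (hs : ω.entropyDensitySup = 2 * Real.log 2) {m : ℕ} (hm : 1 ≤ m) (hmq : ∀ i, (q i + 1) ∣ m)
    (B : FermionOp (halfOpenBox d m)) :
    ω.expect (halfOpenBox d m) B = B.trace / Fintype.card (Finset (Orb (PolySite (halfOpenBox d m)))) := by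
  have hge := hω.entropyDensitySup_le_boxEntropyDensity hd hm hmq
  rw [hs, InfVolFermionState.boxEntropyDensity_apply, le_div_iff₀ (by positivity)] at hge
  have hle := vonNeumannEntropy_le_log_card (ω.rdm_posSemidef (halfOpenBox d m)) (ω.trace_rdm _)
  have hlog := log_card_fock_polySite' (halfOpenBox d m)
  rw [card_halfOpenBox] at hlog
  push_cast at hlog
  have hSeq : vonNeumannEntropy (ω.rdm (halfOpenBox d m)) = Real.log (Fintype.card (Finset (Orb (PolySite (halfOpenBox d m))))) := by
    apply le_antisymm hle
    rw [hlog]; linarith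
  rw [← trace_rdm_mul]
  exact Matrix.trace_mul_eq_of_vonNeumannEntropy_eq_log_card (ω.rdm_posSemidef _) (ω.trace_rdm _) hSeq B

variable (hd : 0 < d) {Ψ : FermionInteraction d} {R : ℝ} (hH : Ψ.IsHermitian) (hE : Ψ.IsEven)
  (hT : Ψ.IsTranslationInvariant) (hR : Ψ.HasFiniteRange R) {q : Fin d → ℕ} {ω : InfVolFermionState d}
include hd hH hE hT hR

/-- A periodic equilibrium state at `β = 0` has maximal entropy density `s̄(ω) = P_q(0) = P_free(0) = 2 log 2`.
[cite: BratteliRobinsonII1997, Thm. 6.2.40] -/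
theorem InfVolFermionState.IsPerVarEquilibrium.entropyDensitySup_eq_of_zero (h : ω.IsPerVarEquilibrium 0 q Ψ R) :
    ω.entropyDensitySup = 2 * Real.log 2 := by
  have h2 := h.2
  rw [zero_mul, sub_zero, Ψ.perVarPressure_eq_freePressure hd hH hE hT hR le_rfl q, Ψ.freePressure_zero hd hH hE hT hR] at h2
  exact h2

/-- **`(C-1)` for periodic equilibrium states at `β = 0`**: such a state is tracial on every aligned box, hence
`Im ω(Ãᴴ(H_{Λ'}Ã − ÃH_{Λ'})) = 0` for every local `A` (place `Λ'` in an aligned box by a superlattice translation).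
[cite: ArakiMoriya2003, Theorem 12.11] -/
theorem InfVolFermionState.IsPerVarEquilibrium.im_expect_conjTranspose_mul_commutator_eq_zero_of_zero (h : ω.IsPerVarEquilibrium 0 q Ψ R)
    {Λ Λ' : Finset (Site d)} (hΛR : thicken Λ R ⊆ Λ') (A : FermionOp Λ) :
    (ω.expect Λ' ((fermionEmbed (PolySite.incl ((subset_thicken Λ R).trans hΛR)) A)ᴴ *
      (Ψ.localHamiltonian Λ' * fermionEmbed (PolySite.incl ((subset_thicken Λ R).trans hΛR)) A -
        fermionEmbed (PolySite.incl ((subset_thicken Λ R).trans hΛR)) A * Ψ.localHamiltonian Λ'))).im = 0 := by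
  classical
  have hs := h.entropyDensitySup_eq_of_zero hd hH hE hT hR
  obtain ⟨N, hN1, hNq⟩ : ∃ N : ℕ, 1 ≤ N ∧ ∀ i, (q i + 1) ∣ N :=
    ⟨∏ i, (q i + 1), Finset.prod_pos fun i _ => Nat.succ_pos _, InfVolFermionState.dvd_prod_succ q⟩
  obtain ⟨z₀, w₀, hv⟩ := exists_superlatVec_shiftSet_subset_halfOpenBox q hN1 Λ'
  have hle : w₀ * N ≤ (w₀ + 1) * N := Nat.mul_le_mul_right N (Nat.le_succ w₀)
  have hmono : halfOpenBox d (w₀ * N) ⊆ halfOpenBox d ((w₀ + 1) * N) := fun x hx => by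
    rw [mem_halfOpenBox] at hx ⊢
    exact fun i => ⟨(hx i).1, (hx i).2.trans_le (by exact_mod_cast hle)⟩
  have hu : shiftSet (superlatVec q z₀) Λ' ⊆ halfOpenBox d ((w₀ + 1) * N) := hv.trans hmono
  have hm1 : 1 ≤ (w₀ + 1) * N := Nat.one_le_iff_ne_zero.2 (Nat.mul_ne_zero (Nat.succ_ne_zero w₀) (by omega))
  have hmq : ∀ i, (q i + 1) ∣ (w₀ + 1) * N := fun i => Dvd.dvd.mul_left (hNq i) _
  set a := fermionEmbed (PolySite.incl ((subset_thicken Λ R).trans hΛR)) A with ha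
  set K := Ψ.localHamiltonian Λ' with hK
  set Tu := fermionEmbed ((PolySite.shiftEmb (superlatVec q z₀) Λ').trans (PolySite.incl hu)) with hTu
  have hKt : (Tu K).IsHermitian := by
    rw [Matrix.IsHermitian, ← fermionEmbed_conjTranspose, (FermionInteraction.localHamiltonian_isHermitian hH Λ').eq]
  have htrace : (Tu (aᴴ * (K * a - a * K))).trace.im = 0 := by
    rw [map_mul, map_sub, map_mul, map_mul, fermionEmbed_conjTranspose, Matrix.mul_sub, Matrix.trace_sub, Complex.sub_im]
    have h1 : ((Tu a)ᴴ * (Tu K * Tu a)).trace.im = 0 := by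
      rw [← Matrix.mul_assoc]; exact im_trace_eq_zero_of_isHermitian' (Matrix.isHermitian_conjTranspose_mul_mul (Tu a) hKt)
    have h2 : ((Tu a)ᴴ * (Tu a * Tu K)).trace.im = 0 := by
      rw [Matrix.trace_mul_comm]; exact im_trace_eq_zero_of_isHermitian' (Matrix.isHermitian_mul_mul_conjTranspose (Tu a) hKt)
    rw [h1, h2, sub_zero]
  rw [← h.1.expect_fermionEmbed_shiftEmb_trans_incl z₀ hu, h.1.expect_eq_trace_div_of_entropy_max hd hs hm1 hmq,
    Complex.div_natCast_im, htrace, zero_div]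

end InfiniteTemperature

/-! #### `(C-1)` at every `β ≥ 0` and stationarity -/

section Consequences

variable (hd : 0 < d) {Ψ : FermionInteraction d} {R : ℝ} (hH : Ψ.IsHermitian) (hE : Ψ.IsEven)
  (hT : Ψ.IsTranslationInvariant) (hR : Ψ.HasFiniteRange R) {β : ℝ} (hβ : 0 ≤ β) {q : Fin d → ℕ} {ω : InfVolFermionState d}
include hd hH hE hT hR hβ

/-- **`(C-1)` FOR PERIODIC EQUILIBRIUM STATES** (`β ≥ 0`; the cases `β > 0` / `β = 0` combined): `Im ω(Ãᴴ(H_{Λ'}Ã − ÃH_{Λ'})) = 0`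
for every local `A`. [cite: ArakiMoriya2003, Theorem 12.11] -/
theorem InfVolFermionState.IsPerVarEquilibrium.im_expect_conjTranspose_mul_commutator_eq_zero (h : ω.IsPerVarEquilibrium β q Ψ R)
    {Λ Λ' : Finset (Site d)} (hΛR : thicken Λ R ⊆ Λ') (A : FermionOp Λ) :
    (ω.expect Λ' ((fermionEmbed (PolySite.incl ((subset_thicken Λ R).trans hΛR)) A)ᴴ *
      (Ψ.localHamiltonian Λ' * fermionEmbed (PolySite.incl ((subset_thicken Λ R).trans hΛR)) A -
        fermionEmbed (PolySite.incl ((subset_thicken Λ R).trans hΛR)) A * Ψ.localHamiltonian Λ'))).im = 0 := by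
  rcases hβ.eq_or_lt with h0 | hpos
  · subst h0
    exact h.im_expect_conjTranspose_mul_commutator_eq_zero_of_zero hd hH hE hT hR hΛR A
  · exact h.im_expect_conjTranspose_mul_commutator_eq_zero_of_pos hd hH hE hT hR hβ hpos hΛR A

/-- **STATIONARITY OF PERIODIC EQUILIBRIUM STATES**: `ω(H_{Λ'}Ã − ÃH_{Λ'}) = 0`, i.e. `ω(δ_Ψ A) = 0`, for EVERY local `A`
(charged included; `(C-1)` polarised). [cite: ArakiMoriya2003, Theorem 12.11] [cite: FawziFawziScalet2024, arXiv §3.1 Thm 3.1 (4)] -/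
theorem InfVolFermionState.IsPerVarEquilibrium.expect_commutator_localHamiltonian_eq_zero (h : ω.IsPerVarEquilibrium β q Ψ R)
    {Λ Λ' : Finset (Site d)} (hΛR : thicken Λ R ⊆ Λ') (A : FermionOp Λ) :
    ω.expect Λ' (Ψ.localHamiltonian Λ' * fermionEmbed (PolySite.incl ((subset_thicken Λ R).trans hΛR)) A -
      fermionEmbed (PolySite.incl ((subset_thicken Λ R).trans hΛR)) A * Ψ.localHamiltonian Λ') = 0 :=
  ω.expect_commutator_eq_zero_of_localDKMS ((subset_thicken Λ R).trans hΛR) (Ψ.localHamiltonian Λ')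
    (fun B => h.im_expect_conjTranspose_mul_commutator_eq_zero hd hH hE hT hR hβ hΛR B) A

/-- The tangent row in the three real moments `x = Re ω(ÃᴴÃ)`, `y = Re ω(ÃÃᴴ)`, `E = Re ω(Ãᴴ[H_{Λ'},Ã])`: `s x − q' y ≤ β E` for
`e^{s−1} ≤ q'`. [cite: ArakiMoriya2003, Theorem 12.11] -/
theorem InfVolFermionState.IsPerVarEquilibrium.eebRow_moments (h : ω.IsPerVarEquilibrium β q Ψ R)
    {Λ Λ' : Finset (Site d)} (hΛR : thicken Λ R ⊆ Λ') (A : FermionOp Λ) {s q' : ℝ} (hq : Real.exp (s - 1) ≤ q') :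
    s * (ω.expect Λ' ((fermionEmbed (PolySite.incl ((subset_thicken Λ R).trans hΛR)) A)ᴴ *
          fermionEmbed (PolySite.incl ((subset_thicken Λ R).trans hΛR)) A)).re -
        q' * (ω.expect Λ' (fermionEmbed (PolySite.incl ((subset_thicken Λ R).trans hΛR)) A *
          (fermionEmbed (PolySite.incl ((subset_thicken Λ R).trans hΛR)) A)ᴴ)).re ≤
      β * (ω.expect Λ' ((fermionEmbed (PolySite.incl ((subset_thicken Λ R).trans hΛR)) A)ᴴ *
        (Ψ.localHamiltonian Λ' * fermionEmbed (PolySite.incl ((subset_thicken Λ R).trans hΛR)) A -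
          fermionEmbed (PolySite.incl ((subset_thicken Λ R).trans hΛR)) A * Ψ.localHamiltonian Λ'))).re := by
  have h' := h.re_expect_eebRow_nonneg hd hH hE hT hR hβ hΛR A hq
  rw [map_add, map_sub, map_smul, map_smul, map_smul, Complex.add_re, Complex.sub_re, smul_eq_mul, smul_eq_mul, smul_eq_mul,
    Complex.re_ofReal_mul, Complex.re_ofReal_mul, Complex.re_ofReal_mul] at h'
  linarith

end Consequences

/-! ### §5 Bogoliubov's inequality for periodic equilibrium states -/

/-- The row operator read through a linear functional. [folklore] -/
private theorem re_apply_bogRow' {m : Type*} [Fintype m] (φ : Matrix m m ℂ →ₗ[ℂ] ℂ) (a c Z : Matrix m m ℂ) (β : ℝ) :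
    (φ (a * aᴴ + aᴴ * a + ((2 : ℝ) : ℂ) • (c * a - a * c) + ((β / 2 : ℝ) : ℂ) • (cᴴ * Z - Z * cᴴ))).re =
      (φ (a * aᴴ + aᴴ * a)).re + 2 * (φ (c * a - a * c)).re + β / 2 * (φ (cᴴ * Z - Z * cᴴ)).re := by
  rw [map_add, map_add, map_smul, map_smul, Complex.add_re, Complex.add_re, smul_eq_mul, smul_eq_mul, Complex.re_ofReal_mul,
    Complex.re_ofReal_mul]

section Bogoliubov

variable (hd : 0 < d) {Ψ : FermionInteraction d} {R : ℝ} (hH : Ψ.IsHermitian) (hE : Ψ.IsEven)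
  (hT : Ψ.IsTranslationInvariant) (hR : Ψ.HasFiniteRange R) {β : ℝ} (hβ : 0 ≤ β) {q : Fin d → ℕ} {ω : InfVolFermionState d}
include hd hH hE hT hR hβ

/-- **BOGOLIUBOV'S INEQUALITY FOR PERIODIC EQUILIBRIUM STATES, row form.** Let `Ψ` be Hermitian, even, translation covariant, of
finite range `R` on `ℤ^d` (`d ≥ 1`), `β ≥ 0`, and `ω.IsPerVarEquilibrium β q Ψ R`. Then for all finite `Λ`, `Λ' ⊇ thicken Λ R` and all
`A, C ∈ 𝔄_Λ`: `0 ≤ Re ω(ÃÃᴴ + ÃᴴÃ) + 2 Re ω(C̃Ã − ÃC̃) + ½β Re ω(C̃ᴴ(H_{Λ'}C̃ − C̃H_{Λ'}) − (H_{Λ'}C̃ − C̃H_{Λ'})C̃ᴴ)`.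
[cite: DLS1978, §2 eq. (28)] [cite: KleinLandauShucker1981] [cite: ArakiMoriya2003, Theorem 12.11] -/
theorem InfVolFermionState.IsPerVarEquilibrium.bogoliubovRow_nonneg (h : ω.IsPerVarEquilibrium β q Ψ R)
    {Λ Λ' : Finset (Site d)} (hΛR : thicken Λ R ⊆ Λ') (A C : FermionOp Λ) :
    0 ≤ (ω.expect Λ' (fermionEmbed (PolySite.incl ((subset_thicken Λ R).trans hΛR)) A *
            (fermionEmbed (PolySite.incl ((subset_thicken Λ R).trans hΛR)) A)ᴴ +
          (fermionEmbed (PolySite.incl ((subset_thicken Λ R).trans hΛR)) A)ᴴ *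
            fermionEmbed (PolySite.incl ((subset_thicken Λ R).trans hΛR)) A)).re +
      2 * (ω.expect Λ' (fermionEmbed (PolySite.incl ((subset_thicken Λ R).trans hΛR)) C *
            fermionEmbed (PolySite.incl ((subset_thicken Λ R).trans hΛR)) A -
          fermionEmbed (PolySite.incl ((subset_thicken Λ R).trans hΛR)) A *
            fermionEmbed (PolySite.incl ((subset_thicken Λ R).trans hΛR)) C)).re +
      β / 2 * (ω.expect Λ' ((fermionEmbed (PolySite.incl ((subset_thicken Λ R).trans hΛR)) C)ᴴ *
            (Ψ.localHamiltonian Λ' * fermionEmbed (PolySite.incl ((subset_thicken Λ R).trans hΛR)) C -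
              fermionEmbed (PolySite.incl ((subset_thicken Λ R).trans hΛR)) C * Ψ.localHamiltonian Λ') -
          (Ψ.localHamiltonian Λ' * fermionEmbed (PolySite.incl ((subset_thicken Λ R).trans hΛR)) C -
              fermionEmbed (PolySite.incl ((subset_thicken Λ R).trans hΛR)) C * Ψ.localHamiltonian Λ') *
            (fermionEmbed (PolySite.incl ((subset_thicken Λ R).trans hΛR)) C)ᴴ)).re := by
  classical
  set Γ := fermionEmbed (PolySite.incl ((subset_thicken Λ R).trans hΛR)) with hΓ
  set a := Γ A with ha
  set c := Γ C with hc
  set Z : FermionOp Λ' := Ψ.localHamiltonian Λ' * c - c * Ψ.localHamiltonian Λ' with hZ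
  set M : FermionOp Λ' := a * aᴴ + aᴴ * a + ((2 : ℝ) : ℂ) • (c * a - a * c) + ((β / 2 : ℝ) : ℂ) • (cᴴ * Z - Z * cᴴ) with hM
  set X : FermionOp Λ' := (2 : ℂ)⁻¹ • ((2 : ℂ)⁻¹ • (M + Mᴴ) + parityAut ((2 : ℂ)⁻¹ • (M + Mᴴ))) with hXdef
  have hωX : ω.expect Λ' X = ((ω.expect Λ' M).re : ℂ) :=
    apply_evenHermPart_eq (ω.expect_conjTranspose Λ') ((h.1.isEven hd) Λ') M
  have hre : (ω.expect Λ' M).re = (ω.expect Λ' X).re := by rw [hωX, Complex.ofReal_re]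
  rw [← re_apply_bogRow' (ω.expect Λ') a c Z β, ← hM, hre]
  -- the volume-independent first-order constant `½(K_C + K_{Cᴴ})`, `K_B = ‖B‖·|Λ||Λ'|·2‖X‖‖B‖`
  refine h.re_expect_nonneg_of_gibbs_perturbation_const hd hH hE hT hR hβ (isHermitian_evenHermPart M)
    (C := (‖C‖ * ((Λ.card * Λ'.card : ℕ) * (2 * ‖X‖ * ‖C‖)) + ‖Cᴴ‖ * ((Λ.card * Λ'.card : ℕ) * (2 * ‖X‖ * ‖Cᴴ‖))) / 2)
    (div_nonneg (add_nonneg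
      (mul_nonneg (norm_nonneg _) (mul_nonneg (Nat.cast_nonneg _) (mul_nonneg (mul_nonneg zero_le_two (norm_nonneg _)) (norm_nonneg _))))
      (mul_nonneg (norm_nonneg _) (mul_nonneg (Nat.cast_nonneg _) (mul_nonneg (mul_nonneg zero_le_two (norm_nonneg _)) (norm_nonneg _)))))
      zero_le_two) fun n G hG u hu t ht => ?_
  -- the finite-volume row in the box `[0, n)^d`
  set Kn := Ψ.localHamiltonian (halfOpenBox d n) with hKn
  set Y := ∑ u' ∈ G.attach, fermionEmbed ((PolySite.shiftEmb u'.1 Λ').trans (PolySite.incl (hG u'.1 u'.2))) X with hYdef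
  have hYh : Y.IsHermitian := isHermitian_sum_offsets (isHermitian_evenHermPart M) hG
  have hYe : parityAut Y = Y := parityAut_sum_offsets (parityAut_evenHermPart M) hG
  have hKh : Kn.IsHermitian := FermionInteraction.localHamiltonian_isHermitian hH _
  have hKe : parityAut Kn = Kn := FermionInteraction.parityAut_localHamiltonian hE _
  have hH₀ : (((β : ℝ) : ℂ) • Kn).IsHermitian := by
    rw [Matrix.IsHermitian, conjTranspose_smul, hKh.eq]; simp only [Complex.star_def, Complex.conj_ofReal]
  have hHt : (((β : ℝ) : ℂ) • Kn + (t : ℂ) • Y).IsHermitian := by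
    refine hH₀.add ?_
    rw [Matrix.IsHermitian, conjTranspose_smul, hYh.eq]; simp only [Complex.star_def, Complex.conj_ofReal]
  have hHe : parityAut (((β : ℝ) : ℂ) • Kn + (t : ℂ) • Y) = ((β : ℝ) : ℂ) • Kn + (t : ℂ) • Y := by
    rw [map_add, map_smul, map_smul, hKe, hYe]
  set Tu := fermionEmbed ((PolySite.shiftEmb u Λ').trans (PolySite.incl (hG u hu))) with hTu
  -- the translate of the row operator is the row operator of the translates, against `βK_n`
  have hloc := Ψ.localHamiltonian_halfOpenBox_commutator_translate hE hT hR hΛR (hG u hu) C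
  have hTZ : Tu Z = Kn * Tu c - Tu c * Kn := by rw [hZ, hc, hΓ, ← hloc]
  have hTM : Tu M = Tu a * (Tu a)ᴴ + (Tu a)ᴴ * Tu a + ((2 : ℝ) : ℂ) • (Tu c * Tu a - Tu a * Tu c) +
      ((β / 2 : ℝ) : ℂ) • ((Tu c)ᴴ * (Kn * Tu c - Tu c * Kn) - (Kn * Tu c - Tu c * Kn) * (Tu c)ᴴ) := by
    rw [hM, map_add, map_add, map_smul, map_smul, map_add, map_sub, map_sub, map_mul, map_mul, map_mul, map_mul, map_mul, map_mul,
      hTZ, fermionEmbed_conjTranspose, fermionEmbed_conjTranspose]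
  have hgX : gibbsState 1 (((β : ℝ) : ℂ) • Kn + (t : ℂ) • Y) (Tu X) =
      (((gibbsState 1 (((β : ℝ) : ℂ) • Kn + (t : ℂ) • Y) (Tu M)).re : ℂ)) := by
    rw [hXdef, fermionEmbed_evenHermPart]
    exact apply_evenHermPart_eq (fun B => gibbsState_conjTranspose 1 hHt B)
      (fun B => gibbsState_parityAut_of_parityAut_eq hHe 1 B) (Tu M)
  rw [hgX, Complex.ofReal_re, hTM, re_apply_bogRow']
  -- the matrix row against `βK_n`
  have h' := hH₀.re_gibbsState_bogoliubovRow_perturb_ge hYh t (Tu a) (Tu c)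
  have hsc : (Tu c)ᴴ * ((((β : ℝ) : ℂ) • Kn) * Tu c - Tu c * (((β : ℝ) : ℂ) • Kn)) -
      ((((β : ℝ) : ℂ) • Kn) * Tu c - Tu c * (((β : ℝ) : ℂ) • Kn)) * (Tu c)ᴴ =
        ((β : ℝ) : ℂ) • ((Tu c)ᴴ * (Kn * Tu c - Tu c * Kn) - (Kn * Tu c - Tu c * Kn) * (Tu c)ᴴ) := by
    rw [Matrix.smul_mul, Matrix.mul_smul, ← smul_sub, Matrix.mul_smul, Matrix.smul_mul, ← smul_sub]
  rw [hsc, map_smul, smul_eq_mul, Complex.re_ofReal_mul, abs_of_nonneg ht] at h'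
  -- the first-order constants
  have h1 := norm_conjTranspose_mul_commutator_sum_offsets_le ((subset_thicken Λ R).trans hΛR) C (parityAut_evenHermPart M) hG
    (hG u hu)
  have h2 := norm_conjTranspose_mul_commutator_sum_offsets_le ((subset_thicken Λ R).trans hΛR) Cᴴ (parityAut_evenHermPart M) hG
    (hG u hu)
  rw [fermionEmbed_conjTranspose, fermionEmbed_conjTranspose, conjTranspose_conjTranspose] at h2
  rw [← hXdef, ← hYdef, ← hΓ, ← hc, ← hTu] at h1 h2
  have h12 : t / 2 * (‖(Tu c)ᴴ * (Y * Tu c - Tu c * Y)‖ + ‖Tu c * (Y * (Tu c)ᴴ - (Tu c)ᴴ * Y)‖) ≤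
      t * ((‖C‖ * ((Λ.card * Λ'.card : ℕ) * (2 * ‖X‖ * ‖C‖)) + ‖Cᴴ‖ * ((Λ.card * Λ'.card : ℕ) * (2 * ‖X‖ * ‖Cᴴ‖))) / 2) := by
    nlinarith [h1, h2, ht]
  have e : 1 / 2 * (β * (gibbsState 1 (((β : ℝ) : ℂ) • Kn + (t : ℂ) • Y)
      ((Tu c)ᴴ * (Kn * Tu c - Tu c * Kn) - (Kn * Tu c - Tu c * Kn) * (Tu c)ᴴ)).re) =
      β / 2 * (gibbsState 1 (((β : ℝ) : ℂ) • Kn + (t : ℂ) • Y)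
        ((Tu c)ᴴ * (Kn * Tu c - Tu c * Kn) - (Kn * Tu c - Tu c * Kn) * (Tu c)ᴴ)).re := by ring
  linarith

/-- **BOGOLIUBOV'S INEQUALITY FOR PERIODIC EQUILIBRIUM STATES** (Dyson–Lieb–Simon (28) in infinite volume):
`‖ω(C̃Ã − ÃC̃)‖² ≤ ½β · Re ω(ÃÃᴴ + ÃᴴÃ) · Re ω(C̃ᴴ[H_{Λ'},C̃] − [H_{Λ'},C̃]C̃ᴴ)` for all local `A, C ∈ 𝔄_Λ`, `Λ' ⊇ thicken Λ R`, in
every `q`-periodic equilibrium state of a Hermitian even translation-covariant finite-range interaction at `β ≥ 0`.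
[cite: DLS1978, §2 eq. (28)] [cite: KleinLandauShucker1981] [cite: ArakiMoriya2003, Theorem 12.11] -/
theorem InfVolFermionState.IsPerVarEquilibrium.bogoliubov_inequality (h : ω.IsPerVarEquilibrium β q Ψ R)
    {Λ Λ' : Finset (Site d)} (hΛR : thicken Λ R ⊆ Λ') (A C : FermionOp Λ) :
    ‖ω.expect Λ' (fermionEmbed (PolySite.incl ((subset_thicken Λ R).trans hΛR)) C *
          fermionEmbed (PolySite.incl ((subset_thicken Λ R).trans hΛR)) A -
        fermionEmbed (PolySite.incl ((subset_thicken Λ R).trans hΛR)) A *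
          fermionEmbed (PolySite.incl ((subset_thicken Λ R).trans hΛR)) C)‖ ^ 2 ≤
      β / 2 * (ω.expect Λ' (fermionEmbed (PolySite.incl ((subset_thicken Λ R).trans hΛR)) A *
            (fermionEmbed (PolySite.incl ((subset_thicken Λ R).trans hΛR)) A)ᴴ +
          (fermionEmbed (PolySite.incl ((subset_thicken Λ R).trans hΛR)) A)ᴴ *
            fermionEmbed (PolySite.incl ((subset_thicken Λ R).trans hΛR)) A)).re *
        (ω.expect Λ' ((fermionEmbed (PolySite.incl ((subset_thicken Λ R).trans hΛR)) C)ᴴ *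
            (Ψ.localHamiltonian Λ' * fermionEmbed (PolySite.incl ((subset_thicken Λ R).trans hΛR)) C -
              fermionEmbed (PolySite.incl ((subset_thicken Λ R).trans hΛR)) C * Ψ.localHamiltonian Λ') -
          (Ψ.localHamiltonian Λ' * fermionEmbed (PolySite.incl ((subset_thicken Λ R).trans hΛR)) C -
              fermionEmbed (PolySite.incl ((subset_thicken Λ R).trans hΛR)) C * Ψ.localHamiltonian Λ') *
            (fermionEmbed (PolySite.incl ((subset_thicken Λ R).trans hΛR)) C)ᴴ)).re := by
  classical
  set Γ := fermionEmbed (PolySite.incl ((subset_thicken Λ R).trans hΛR)) with hΓ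
  set H := Ψ.localHamiltonian Λ' with hHdef
  set z : ℂ := ω.expect Λ' (Γ C * Γ A - Γ A * Γ C) with hz
  set P : ℝ := (ω.expect Λ' (Γ A * (Γ A)ᴴ + (Γ A)ᴴ * Γ A)).re with hP
  set Q : ℝ := (ω.expect Λ' ((Γ C)ᴴ * (H * Γ C - Γ C * H) - (H * Γ C - Γ C * H) * (Γ C)ᴴ)).re with hQ
  -- the rows for `A ↦ μ • A`, `μ ∈ ℂ`: `0 ≤ |μ|² P + 2 Re(μ z) + ½β Q`
  have hrow : ∀ μ : ℂ, 0 ≤ ‖μ‖ ^ 2 * P + 2 * (μ * z).re + β / 2 * Q := by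
    intro μ
    have h' := h.bogoliubovRow_nonneg hd hH hE hT hR hβ hΛR (μ • A) C
    have e1 : Γ (μ • A) * (Γ (μ • A))ᴴ + (Γ (μ • A))ᴴ * Γ (μ • A) = ((‖μ‖ ^ 2 : ℝ) : ℂ) • (Γ A * (Γ A)ᴴ + (Γ A)ᴴ * Γ A) := by
      simp only [map_smul, conjTranspose_smul, Complex.star_def, Matrix.smul_mul, Matrix.mul_smul, smul_smul]
      rw [Complex.mul_conj', Complex.conj_mul', ← smul_add, Complex.ofReal_pow]
    have e2 : Γ C * Γ (μ • A) - Γ (μ • A) * Γ C = μ • (Γ C * Γ A - Γ A * Γ C) := by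
      rw [map_smul, Matrix.mul_smul, Matrix.smul_mul, smul_sub]
    rw [← hΓ, ← hHdef, e1, e2, map_smul, map_smul, smul_eq_mul, smul_eq_mul, Complex.re_ofReal_mul, ← hz, ← hP, ← hQ] at h'
    exact h'
  have hP0 : 0 ≤ P := by
    have h1 : 0 ≤ (ω.expect Λ' (Γ A * (Γ A)ᴴ)).re := by
      have h' := ω.expect_nonneg Λ' (Γ A)ᴴ
      rw [conjTranspose_conjTranspose] at h'
      exact (Complex.nonneg_iff.1 h').1
    have h2 : 0 ≤ (ω.expect Λ' ((Γ A)ᴴ * Γ A)).re := (Complex.nonneg_iff.1 (ω.expect_nonneg Λ' (Γ A))).1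
    rw [hP, map_add, Complex.add_re]; exact add_nonneg h1 h2
  have hQ0 : 0 ≤ β / 2 * Q := by
    have h' := hrow 0
    rwa [norm_zero, zero_pow two_ne_zero, zero_mul, zero_mul, Complex.zero_re, mul_zero, zero_add, zero_add] at h'
  -- the real quadratic `s ↦ ‖z‖²P s² − 2‖z‖² s + ½βQ ≥ 0` (`μ = −s z̄`) has nonpositive discriminant
  have hquad : ∀ s : ℝ, 0 ≤ ‖z‖ ^ 2 * P * (s * s) + -(2 * ‖z‖ ^ 2) * s + β / 2 * Q := by
    intro s
    have h' := hrow (-((s : ℂ) * (starRingEnd ℂ) z))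
    have hn : ‖-((s : ℂ) * (starRingEnd ℂ) z)‖ ^ 2 = s ^ 2 * ‖z‖ ^ 2 := by
      rw [norm_neg, norm_mul, Complex.norm_real, Complex.norm_conj, mul_pow, Real.norm_eq_abs, sq_abs]
    have hre : (-((s : ℂ) * (starRingEnd ℂ) z) * z).re = -(s * ‖z‖ ^ 2) := by
      rw [neg_mul, Complex.neg_re, mul_assoc, Complex.conj_mul', ← Complex.ofReal_pow, ← Complex.ofReal_mul, Complex.ofReal_re]
    rw [hn, hre] at h'
    have e : ‖z‖ ^ 2 * P * (s * s) + -(2 * ‖z‖ ^ 2) * s + β / 2 * Q = s ^ 2 * ‖z‖ ^ 2 * P + 2 * -(s * ‖z‖ ^ 2) + β / 2 * Q := by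
      ring
    rw [e]; exact h'
  have hdisc := discrim_le_zero hquad
  rw [discrim] at hdisc
  show ‖z‖ ^ 2 ≤ β / 2 * P * Q
  rcases (sq_nonneg ‖z‖).eq_or_lt with hz0 | hzpos
  · rw [← hz0]
    have e : β / 2 * P * Q = P * (β / 2 * Q) := by ring
    rw [e]; exact mul_nonneg hP0 hQ0
  · have hfin : ‖z‖ ^ 2 * ‖z‖ ^ 2 ≤ ‖z‖ ^ 2 * (β / 2 * P * Q) := by nlinarith [hdisc]
    exact le_of_mul_le_mul_left hfin hzpos

end Bogoliubov

end Literature.MathematicalPhysics.QuantumLattice
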